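import Summits.BirchSwinnertonDyer.BirchSwinnertonDyer.Theorems.EisensteinDepletionAtTwoStarOptBNSFNsfReduction
import Summits.BirchSwinnertonDyer.BirchSwinnertonDyer.Theorems.EisensteinDepletionAtTwoStarOptBNSFX1OptimalOfModularity
import Summits.BirchSwinnertonDyer.BirchSwinnertonDyer.Theorems.EisensteinDepletionAtTwoStarRestrictedGlue
import HarnessLib

/-!
# Crux `StarOptBNSF` (stmt-BirchSwinnertonDyer-27047) and its parent `E1M_NSF` = `DepletedLambdaLawAtTwoModNSF`
# (stmt-BirchSwinnertonDyer-27021): BY NAME from the ONE research statement «Stevens at 2 for the `X₁(N)`-optimal curve»,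
# the sibling crux `StarGO2Sigma` (27046), and two PRINT named facts of the tree (Modularity; Conrad–Edixhoven–Stein 6.1.6)

Lead bsd-rank2-star-p1 GEN 8 — the last bookkeeping step of line `nsf` v9 (planner p2 GEN 33, registered 13:12Z; stubs
`stub_stevensAtTwoX1` RESEARCH + `stub_x1Optimal` PRINT).  eng-2 GEN 18 derived the print stub from the tree's two named facts
(`X1Optimal.x1OptimalLattice_of_modularity`: BCDT modularity `exists_isNewformOf` + `exists_optimal_gamma1ParametrizationData`,
CES 2003 §6.1 Lemma 6.1.6, p637152); lead GEN 8 landed `NsfReduction.starOptBNSF_of_stevensAtTwoX1` (p636203).  Composing: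

* `starOptBNSF_of_stevensAtTwoX1_of_facts` — `exists_isNewformOf → exists_optimal_gamma1ParametrizationData →
  (Stevens-at-2(E₁), E1NF form, traceless odd level) → StarOptBNSF`: the crux 27047 modulo ONE research statement and TWO print
  facts, everything else kernel-checked (p2 GEN 33's announced v10 shape, 13:19:29Z, option (b) of eng-2 13:28:53Z).
* `depletedLambdaLawAtTwoModNSF_of_stevensAtTwoX1` — the PARENT crux `E1M_NSF` (27021) from `StarGO2Sigma` (27046, by name),
  `exists_optimal_gamma1ParametrizationData` and the Stevens-at-2 statement: the modularity input is DISCHARGED by `E1M_NSF`'s own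
  antecedent (its body is `exists_isNewformOf` verbatim), through the landed split glue `depletedLambdaLawAtTwoModNSFOfStar_proof`
  (item 27048, lead GEN 6).  This is the glue of the resplit the tenure planner recorded for later
  (`E1M_NSF ⇐ StarGO2Sigma ∧ StevensAtTwoX1 ∧ ⟨CES 6.1.6 : support⟩`, HANDOFF § p2 GEN 33 addendum), as a tree theorem now.

HONEST FRAMING: conditional reductions of OPEN cruxes; `StarOptBNSF` / `StarGO2Sigma` / `E1M_NSF` / the T-r3₂ leaf / BSD are NOT
proved here; the research statement (cell THEOREM A′'s elliptic face) and the sibling crux remain open; nothing reads an analytic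
rank.

References: G. Stevens, Invent. Math. 98 (1989), §2 [Stevens1989]; B. Conrad, S. Edixhoven, W. Stein, Doc. Math. 8 (2003), §6.1
[ConradEdixhovenStein2003]; C. Breuil, B. Conrad, F. Diamond, R. Taylor, JAMS 14 (2001), Thm. A [BreuilConradDiamondTaylor2001];
S. Ling, J. Oesterlé, Astérisque 196–197 (1991), Thm. 6 [LingOesterle1991].
-/

set_option linter.dupNamespace false
set_option autoImplicit false

noncomputable section

open Literature.NumberTheory.EllipticCurves
open Literature.NumberTheory.EllipticCurves.Greenberg1999
open Literature.NumberTheory.EllipticCurves.ModularForms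

namespace Summit.BirchSwinnertonDyer.BirchSwinnertonDyer.Theorems.DepletionAtTwo.NsfReduction

/-- **`StarOptBNSF` (crux 27047) from Modularity, CES 6.1.6 and «Stevens at 2 for `E₁`».**  Hypotheses: the tree's named facts
`exists_isNewformOf` (BCDT 2001) and `exists_optimal_gamma1ParametrizationData` (Conrad–Edixhoven–Stein 2003, §6.1 Lemma 6.1.6 /
Stevens 1989 §2), and the research statement `stub_stevensAtTwoX1` of line `nsf` v9 (for a globally minimal `W₁`, good ordinary
at `2`, with newform of odd level carrying a traceless prime and Néron lattice `c₁·Λ₁(f)`, no rational 2-torsion abscissa is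
ramified at `2`).  Proof: `X1Optimal.x1OptimalLattice_of_modularity` (eng-2 GEN 18) supplies the `X₁(N)`-optimal curve,
`starOptBNSF_of_stevensAtTwoX1` (lead GEN 8) the rest. [cite: ConradEdixhovenStein2003, §6.1 Lemma 6.1.6] [cite: Stevens1989, §2]
[cite: BreuilConradDiamondTaylor2001, Thm. A] -/
theorem starOptBNSF_of_stevensAtTwoX1_of_facts (hnf : exists_isNewformOf)
    (hex : exists_optimal_gamma1ParametrizationData)
    (hS : ∀ (W₁ : WeierstrassCurve ℚ) [W₁.IsElliptic] [W₁.IsGloballyMinimal]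
      ⦃N : ℕ⦄ [NeZero N] (f : CuspForm (CongruenceSubgroup.Gamma0 N) 2), IsNewformOf W₁ f →
      ¬ 2 ∣ N → (∃ p : ℕ, p.Prime ∧ p ∣ N ∧ cuspCoeff f p = 0) → IsOrdinaryAt W₁ 2 →
      ∀ (L₁ : PeriodPair), IsNeronLatticeOf (W₁.baseChange ℂ) L₁ →
      ∀ (c₁ : ℚ), c₁ ≠ 0 → (∀ z ∈ periodLatticeGamma1 f, (c₁ : ℂ) * z ∈ L₁.lattice) →
      (∀ z ∈ L₁.lattice, ∃ w ∈ periodLatticeGamma1 f, z = (c₁ : ℂ) * w) →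
      ∀ (x₁ : ℚ), HasRationalTwoTorsionX W₁ x₁ → ¬ TwoTorsionRamifiedAtTwo x₁) :
    Summit.BirchSwinnertonDyer.BirchSwinnertonDyer.Theses.EisensteinDepletionAtTwo.StarOptBNSF :=
  starOptBNSF_of_stevensAtTwoX1 hS
    (Summit.BirchSwinnertonDyer.BirchSwinnertonDyer.Theorems.DepletionAtTwo.X1Optimal.x1OptimalLattice_of_modularity hnf hex)

/-- **The parent crux `E1M_NSF` = `DepletedLambdaLawAtTwoModNSF` (item 27021) from the sibling crux `StarGO2Sigma` (27046), the
print fact CES 6.1.6 and «Stevens at 2 for `E₁`».**  The modularity input of `starOptBNSF_of_stevensAtTwoX1_of_facts` is the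
ANTECEDENT of `E1M_NSF` itself (its body is `exists_isNewformOf` verbatim, route rev 4), so it is discharged; the split glue is
the landed `depletedLambdaLawAtTwoModNSFOfStar_proof` (item 27048).  Net: the door's load-bearing crux is, by name and
kernel-checked, `StarGO2Sigma ∧ ⟨CES 2003 L.6.1.6⟩ ∧ ⟨Stevens-at-2(E₁) at traceless odd levels⟩`.
[cite: ConradEdixhovenStein2003, §6.1 Lemma 6.1.6] [cite: Stevens1989, §2] [cite: GreenbergVatsal2000, §3 Thm. (3.12)] -/
theorem depletedLambdaLawAtTwoModNSF_of_stevensAtTwoX1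
    (hex : exists_optimal_gamma1ParametrizationData)
    (hG : Summit.BirchSwinnertonDyer.BirchSwinnertonDyer.Theses.EisensteinDepletionAtTwo.StarGO2Sigma)
    (hS : ∀ (W₁ : WeierstrassCurve ℚ) [W₁.IsElliptic] [W₁.IsGloballyMinimal]
      ⦃N : ℕ⦄ [NeZero N] (f : CuspForm (CongruenceSubgroup.Gamma0 N) 2), IsNewformOf W₁ f →
      ¬ 2 ∣ N → (∃ p : ℕ, p.Prime ∧ p ∣ N ∧ cuspCoeff f p = 0) → IsOrdinaryAt W₁ 2 →
      ∀ (L₁ : PeriodPair), IsNeronLatticeOf (W₁.baseChange ℂ) L₁ →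
      ∀ (c₁ : ℚ), c₁ ≠ 0 → (∀ z ∈ periodLatticeGamma1 f, (c₁ : ℂ) * z ∈ L₁.lattice) →
      (∀ z ∈ L₁.lattice, ∃ w ∈ periodLatticeGamma1 f, z = (c₁ : ℂ) * w) →
      ∀ (x₁ : ℚ), HasRationalTwoTorsionX W₁ x₁ → ¬ TwoTorsionRamifiedAtTwo x₁) :
    Summit.BirchSwinnertonDyer.BirchSwinnertonDyer.Theses.EisensteinDepletionAtTwo.DepletedLambdaLawAtTwoModNSF := by
  intro hmod
  exact Summit.BirchSwinnertonDyer.BirchSwinnertonDyer.Theorems.DepletionAtTwo.depletedLambdaLawAtTwoModNSFOfStar_proof hG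
    (starOptBNSF_of_stevensAtTwoX1_of_facts hmod hex hS) hmod

end Summit.BirchSwinnertonDyer.BirchSwinnertonDyer.Theorems.DepletionAtTwo.NsfReduction

end
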